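import Summits.AtomisticToContinuum.BoseEinsteinCondensation.Theorems.BECGroundStateSOSPeriodicIRBoundTwoSectorLowDefs
import Summits.AtomisticToContinuum.BoseEinsteinCondensation.Theorems.BECGroundStateSOSPeriodicIRBoundTwoSectorKLSTZero
import Summits.AtomisticToContinuum.BoseEinsteinCondensation.Theorems.BECGroundStateSOSPeriodicIRBoundTwoSectorWindowTLow
import Summits.AtomisticToContinuum.BoseEinsteinCondensation.Theorems.BECGroundStateSOSPeriodicIRBoundTwoSectorSectorGaps
import Summits.AtomisticToContinuum.BoseEinsteinCondensation.Theorems.BECGroundStateSOSPeriodicIRBoundTwoSectorLinearFloorArrow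
import Summits.AtomisticToContinuum.BoseEinsteinCondensation.Theorems.BECGroundStateSOSPeriodicIRBoundLatticeSectorEnergyFinite
import Summits.AtomisticToContinuum.BoseEinsteinCondensation.Theorems.BECGroundStateSOSPeriodicIRBoundTwoSectorAeZeroFloating
import Summits.AtomisticToContinuum.BoseEinsteinCondensation.Theorems.BECGroundStateSOSPeriodicIRBoundTwoSectorPairDefs2
import Summits.AtomisticToContinuum.BoseEinsteinCondensation.Theorems.BECGroundStateSOSPeriodicIRBoundTwoSectorKLSTPair
import Summits.AtomisticToContinuum.BoseEinsteinCondensation.Theorems.BECGroundStateSOSPeriodicIRBoundTwoSectorWindowTPair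
import Summits.AtomisticToContinuum.BoseEinsteinCondensation.Theorems.BECGroundStateSOSPeriodicIRBoundTwoSectorExchangeBound
import Summits.AtomisticToContinuum.BoseEinsteinCondensation.Theorems.BECGroundStateSOSPeriodicIRBoundTwoSectorPotCosLower
import Summits.AtomisticToContinuum.BoseEinsteinCondensation.Theorems.BECGroundStateSOSPeriodicIRBoundTwoSectorFsumLower
import Summits.AtomisticToContinuum.BoseEinsteinCondensation.Theorems.BECGroundStateSOSPeriodicIRBoundTwoSectorCondensateFraction
import Summits.AtomisticToContinuum.BoseEinsteinCondensation.Theorems.BECGroundStateSOSPeriodicIRBoundTwoSectorPairSharesReal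
import Summits.AtomisticToContinuum.BoseEinsteinCondensation.Theorems.BECGroundStateSOSPeriodicIRBoundTwoSectorEffectiveGap
import Summits.AtomisticToContinuum.BoseEinsteinCondensation.Theorems.BECGroundStateSOSPeriodicIRBoundTwoSectorSoftLocation
import HarnessLib

/-!
# Line `two-sector-gd-transfer` — checked skeleton for crux `PeriodicIRBound` (stmt-AtomisticToContinuum-3972), v12-c23 ("pointwise floating + soft location": v11 with all nine provable stubs LANDED — the load S1₁ is CERTIFIED EQUIVALENT to the integrable half)

Route `route-AtomisticToContinuum-BECGroundStateSOS`; crux decl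
`Summit.AtomisticToContinuum.BoseEinsteinCondensation.Theses.BECGroundStateSOS.PeriodicIRBound` (FIXED; unfolded by the
landed `Negative.periodicIRBound_iff_split` into the integrable half `∀ v` admissible with `∫ v(|x|)dx < ∞, IRBoundFor v`
and the non-integrable half), concluded BY NAME by `PeriodicIRBound_of` (§5; hypotheses = the registered stubs of §4 by
name, body sorry-free) and `PeriodicIRBound_proof` (the same composition applied to the sorried stubs).
Idea card `Cruxes/PeriodicIRBound/Ideas/two-sector-gd-transfer.md`; line card `Cruxes/PeriodicIRBound/Lines/two-sector-gd-transfer.md`;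
lead seats c11–c21 (v2–v6), c22 (v7/v8 "floating thresholds"), c23 (this reshape, `Cruxes/PeriodicIRBound/PICKED.md`).

**History.** v1 (planner) → v2–v4 (lead c11: Defs p137770; S4 p138298; S3 p138476; S5 p138491; reduction p139109) → v5/v6
(c12/c13; difficulty floor R2 p140152): complete modulo the POOLED PAIR stmt-12620 ∧ stmt-9094 and the scope half S6 →
v7/v8 (c22, FloatingDefs p152359; S4' p152976, S5' p153397, S8 p153818, reductions p155164, normal form p156444): complete
modulo ONE pooled stub S1' `FloatingTwoChannel` (KLS channel inequalities on the test vectors of EVERY near-minimiser,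
floating thresholds `E₀(N) ± μ`, guard `0 ≤ μ₊`) and S6; stmt-9094 left the dependency cone.

**v9-c23 (this file) — the reshape.** Vocabulary and stub statements in the two v9 Defs modules
`Theorems/BECGroundStateSOSPeriodicIRBoundTwoSectorZeroDefs.lean` (part 1, p158945) and `…TwoSectorLowDefs.lean` (part 2;
their docstrings have the details). The pooled load is weakened on THREE independent axes while the landed endgame still
closes the integrable half:
(i) the channel inequalities are asked only on near-minimisers of TOTAL MOMENTUM ZERO (`ChanPlusZero`/`ChanMinusZero`,
`HasTotalMomentum 0 Ψ.ψ`) — the moment inequality (S4₀) and the window arithmetic (S5₀) then give the infrared inequality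
for momentum-zero near-minimisers (`IRBoundZeroWith` / `IRBoundForZero`), upgraded to all near-minimisers by the LANDED
normal form `stub_momentumZeroReduction` (p156444, `C ↦ 2C`, glue `irBoundFor_of_irBoundForZero`); on such states the test
vectors `a†(φ_n)Ψ`, `a(φ_n)Ψ` lie exactly in the sectors `±2πn/L` (`WF.hasTotalMomentum_modeCr/_modeAn`);
(ii) the guard `0 ≤ μ₊` is relaxed to `−Aρ ≤ μ₊` (strategist s2): `Aρ` joins the f-sum constant in `WindowArith.nk_le`;
(iii) the window is the crux's own LOW-MOMENTUM window `2π‖n‖_∞/L ≤ K√ρ` for every `K` (not 12620's fixed ball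
`|p| ≤ K`): nothing downstream needs the ball, and line 1's floor `C⁺` only lives on `|p|² ≤ Cρ` — the fixed-ball arrow
`C⁺ ⇒ FloatingForZero` of census v3 §1.4 has no source of information on `Cρ < |p|² ≤ K²`, the low-window arrow does.
The new pooled stub S1₀ `FloatingTwoChannelLow` is implied by part 1's `FloatingTwoChannelZero`, by S1' (glue
`floatingTwoChannelLow_of_floatingTwoChannel`), hence by stmt-12620 ∧ stmt-9094 (`floatingTwoChannelLow_of_pooled`, through
p155164), and by line 1's residual `C⁺ = LinearParticleHoleFloor` (glue `floatingTwoChannelLow_of_linearFloor` +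
`linearFloorGivesFloatingLow_of`, modulo the registered provable stubs S9a, S9b, S9c, S9') — so S1₀ is the registered
funnel of every line's residual on the integrable half.

**Registered stubs of v9 (8; 6 delegable, all provable now):** S1₀ `stub_floatingTwoChannelLow : FloatingTwoChannelLow`
(POOLED, XL / open-problem strength — it implies the integrable half, hence torus TL-BEC for integrable `v` by
`…DifficultyFloorR2`; the LOAD, held by the lead); S4₀ `stub_klsNearMinimiserTZero : KLSNearMinimiserTZero` (OWN, L — the
landed S4' proof `KLS.klsMomentForT` with the momentum hypothesis threaded); S5₀ `stub_windowAssemblyTLow :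
WindowAssemblyTLow` (OWN, M/L — the landed S5' proof with the momentum hypothesis threaded, `Aρ` absorbed, no `ρ₀`-shrink);
S9a `stub_channelsOfSectorGaps : ChannelsOfSectorGaps` (BY-PRODUCT, M/L — fixed `(N, L)`: two real sector gaps give the two
momentum-zero channel inequalities by the sector variational principle on the exact-momentum test vectors); S9b
`stub_linearFloorGivesFloatingLowOf : LinearFloorGivesFloatingLowOf` (BY-PRODUCT, M/L — filters and window arithmetic:
S9c → S9a → (`C⁺ ⇒` S1₀ per potential, `∫v ≠ 0`)); S9c `stub_latticeSectorEnergyFinite : LatticeSectorEnergyFinite`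
(BY-PRODUCT, M — `E_M(2πn/L) < ⊤` for integrable `v`); S9' `stub_aeZeroFloatingLow : AeZeroFloatingLow` (BY-PRODUCT, M —
a.e.-transport of the free-gas instance p154826); S6 `stub_nonIntegrableHalf : NonIntegrableHalf` (SCOPE, XL, unchanged since
v1, = C⁺(1) via p136757). By-products LANDED with the Defs modules: `stub_integrableHalfOfFloatingZero` (p158945),
`stub_integrableHalfOfFloatingLow`. The v8 stub `stub_floatingTwoChannel` is RETIRED from the skeleton (it survives as a
sufficient condition: corollary `PeriodicIRBound_of_strict`).

**v10-c23 (wave 1 integrated, 2026-08-17T13:1xZ):** all six delegable stubs LANDED (`--supports`, 0 bounces) — S4₀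
`stub_klsNearMinimiserTZero` p160279 (`…TwoSectorKLSTZero.lean`), S5₀ `stub_windowAssemblyTLow` p160319 (`…TwoSectorWindowTLow.lean`),
S9a `stub_channelsOfSectorGaps` p160384 (`…TwoSectorSectorGaps.lean`), S9b `stub_linearFloorGivesFloatingLowOf` p160612
(`…TwoSectorLinearFloorArrow.lean`), S9c `stub_latticeSectorEnergyFinite` p160421 (`…LatticeSectorEnergyFinite.lean`), S9'
`stub_aeZeroFloatingLow` p160400 (`…TwoSectorAeZeroFloating.lean`); all imported, their names resolve to the landed theorems.
The skeleton has exactly TWO `sorry`s: S1₀ `FloatingTwoChannelLow` (pooled, open-problem strength) and S6 `NonIntegrableHalf`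
(scope). KERNEL-CHECKED FUNNEL: `C⁺ = LinearParticleHoleFloor ⇒ S1₀` (`floatingTwoChannelLow_of_linearParticleHoleFloor` below,
sorry-free), `S1' ⇒ S1₀`, `stmt-12620 ∧ stmt-9094 ⇒ S1₀`, and `S1₀ ∧ S6 ⇒ PeriodicIRBound` (`PeriodicIRBound_of`).

**v11-c23 (the reshape after SOFT-LOCATION.md, 2026-08-17T14:xxZ).** Paper finding (crux dir `SOFT-LOCATION.md`): for
integrable admissible `v` with `∫v > 0`, X(v) = `IRBoundFor v` IMPLIES the floating two-channel bound once the common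
chemical potential may depend on the near-minimiser (free `μ` ⇒ one inequality `nF + M ≥ n(n+1)(2n+1)/b`; hole share
variational; Born cancels the direct term of the two-sided f-sum, whose exchange term is kept and is condensate-dominated by
an elementary slot-0 mean/fluctuation split; BEC 7/8 from X by mode counting; X closes the shares). Vocabulary and stubs in
the v11 Defs module `Theorems/BECGroundStateSOSPeriodicIRBoundTwoSectorPairDefs.lean`: the load becomes S1₁
`FloatingPairTwoChannel` (per-state `μ`; S1₀ ⇒ S1₁ proved), still closing X_int by the endgame run per state (S4₁, S5₁), and
X_int ⇒ S1₁ modulo S11a `ExchangeCondensateBound`, S11e `PotCosLowerBound`, S11b `FsumLowerBound`, S11c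
`CondensateFractionOfIR`, S11d₁ `PairSharesReal`, S11d₂ `SoftLocationOf` (split for sizing into S11d₂ₐ `EffectiveGapOf` and S11d₂ᵦ
`SoftLocationOfGap`, Defs part 2 `…TwoSectorPairDefs2.lean`, glue `softLocationOf_of_split`) — all provable now. When they land,
`floatingPairTwoChannel_iff_integrableHalf` certifies **S1₁ ⟺ X_int**: the two-sector line is an EQUIVALENT reformulation of
the integrable half of the crux (its honest terminal state), and every earlier residual maps into it:
12620 ∧ 9094 ⇒ S1' ⇒ S1₀ ⇒ S1₁, C⁺ ⇒ S1₀ ⇒ S1₁.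

**Registered stubs of v11 (11; 9 delegable/own, all provable now):** S1₁ `stub_floatingPairTwoChannel : FloatingPairTwoChannel`
(POOLED = X_int, held by the lead); S4₁ `stub_klsNearMinimiserPair`; S5₁ `stub_windowAssemblyPair`; S11a
`stub_exchangeCondensateBound`; S11e `stub_potCosLowerBound`; S11b `stub_fsumLowerBound`; S11c `stub_condensateFractionOfIR`;
S11d₁ `stub_pairSharesReal`; S11d₂ₐ `stub_effectiveGapOf`; S11d₂ᵦ `stub_softLocationOfGap`; S6 `stub_nonIntegrableHalf` (scope).

**v12-c23 (wave 2 integrated, 2026-08-17T14:1xZ):** all nine provable v11 stubs LANDED (`--supports`, 0 bounces): S4₁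
`stub_klsNearMinimiserPair` p162986, S5₁ `stub_windowAssemblyPair` p162927, S11a `stub_exchangeCondensateBound` p164262 (the
analytic heart, 393 lines: slot-0 mean/fluctuation split of `WF.exchCoef`), S11e `stub_potCosLowerBound` p164645 (lead), S11b
`stub_fsumLowerBound` p163185, S11c `stub_condensateFractionOfIR` p163320, S11d₁ `stub_pairSharesReal` p162704 (lead), S11d₂ₐ
`stub_effectiveGapOf` p163317, S11d₂ᵦ `stub_softLocationOfGap` p163313. The skeleton has exactly TWO `sorry`s — S1₁
`FloatingPairTwoChannel` and S6 `NonIntegrableHalf` — and §5 proves, SORRY-FREE with standard axioms,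
**`FloatingPairTwoChannel ↔ ∀ v integrable admissible, IRBoundFor v`** (`floatingPair_iff_integrableHalf_holds`) and
**`PeriodicIRBound ↔ FloatingPairTwoChannel ∧ NonIntegrableHalf`** (`periodicIRBound_iff_pair`); the same theorems land as
`Theorems/BECGroundStateSOSPeriodicIRBoundTwoSectorEquivalence.lean` (registered by-products `stub_floatingPairIffIntegrableHalf`,
`stub_periodicIRBoundIffPair`, `stub_periodicIRBoundOfFloatingPair`). TERMINAL READING OF THE LINE: the two-sector /
floating-threshold architecture is an equivalent reformulation of X_int — its open stub S1₁ IS the integrable half of the crux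
(open-problem strength: thermodynamic-limit BEC), and S6 is the crux on the hard-core class; nothing weaker remains.

**Disproof.lean honoured** (§1–§22, md5 0a05ede2, unchanged since 2026-08-16; no `-- Targets` for this line): §5 near-minimiser
load-bearing — `NearMinAt` enters every channel/moment statement as "`∀ η ∃ δ` (after `N`, `L`, `n`)"; §8 no `N`-uniform
slack — `δ` chosen after `N`; §9/§16 free gas — `FloatingForZero 0 K ρ₀ C 0` holds with `μ₊ = μ₋ = 0` for `C ≥ 1/(4π²)`
(p154826 + restriction); §11 ground-state reformulation is what the momentum-zero restriction exploits (unique positive,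
translation-invariant torus ground state at fixed `(N, L)` for integrable `v`: `…ZeroMomentumGapIntegrable`); §12 `k ≠ 0`
kept; §13/§17 constants per `v`; §15 sup norm; §19 `periodicIRBound_iff_split` used by name; §20/§21 hard-core half = S6
untouched; a.e.-class invariance respected (S9').
-/

noncomputable section

open scoped BigOperators ENNReal ComplexConjugate
open Filter MeasureTheory

namespace Summit.AtomisticToContinuum.BoseEinsteinCondensation.Cruxes.PeriodicIRBound.TwoSectorGdTransfer

open Literature.MathematicalPhysics.QuantumManyBody.BoseGas
open Summit.AtomisticToContinuum.BoseEinsteinCondensation.Theses.BECGroundStateSOS (PeriodicIRBound)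
open Summit.AtomisticToContinuum.BoseEinsteinCondensation.Theses.BECTwoSectorGD (GaussianDomination)
open Summit.AtomisticToContinuum.BoseEinsteinCondensation.Theses.BECSectorPoincareTwoScale (EnergyConvexityWindow)
open Summit.AtomisticToContinuum.BoseEinsteinCondensation.Theorems.PeriodicIRBound.Negative
  (IRBoundFor periodicIRBound_iff_split)
open Summit.AtomisticToContinuum.BoseEinsteinCondensation.Cruxes.PeriodicIRBound.LinearPhFloorWagner
  (LinearParticleHoleFloor)

/-! ## §4 Registered stubs (the only `sorry`s of this file) -/

namespace Goal

/-- Statement of S1₁ `stub_floatingPairTwoChannel` (pooled; the load; CERTIFIED ⟺ X_int, §5). -/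
abbrev stub_floatingPairTwoChannel : Prop := FloatingPairTwoChannel
/-- Statement of S6 `stub_nonIntegrableHalf` (scope). -/
abbrev stub_nonIntegrableHalf : Prop := NonIntegrableHalf
-- v11 stubs S4₁ S5₁ S11a S11e S11b S11c S11d₁ S11d₂ₐ S11d₂ᵦ — LANDED (p162986 / p162927 / p164262 / p164645 / p163185 / p163320 /
-- p162704 / p163317 / p163313), imported above, names resolve to the landed theorems; v9/v10 stubs S4₀ S5₀ S9a S9b S9c S9' —
-- LANDED (p160279 / p160319 / p160384 / p160612 / p160421 / p160400); the v10 load S1₀ `FloatingTwoChannelLow` is RETIRED from the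
-- skeleton (it survives as a sufficient condition: `PeriodicIRBound_of_low`).

end Goal

/-- **S1₁ (POOLED; the load; CERTIFIED ⟺ the integrable half of the crux, `floatingPair_iff_integrableHalf_holds`)** — the
per-state floating two-channel bound in the low window: every integrable admissible `v` admits, for every `K > 0`, data with
`FloatingPairLow v K ρ₀ C A`. Open-problem strength (thermodynamic-limit BEC for integrable `v`). -/
theorem stub_floatingPairTwoChannel : FloatingPairTwoChannel := by
  sorry

/-- **S6 (XL, SCOPE, not reduced; unchanged since v1)** — see `NonIntegrableHalf`. -/
theorem stub_nonIntegrableHalf : NonIntegrableHalf := by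
  sorry

/-! ## §5 Composition (real proofs; no `sorry` below this line) -/

/-- **`PeriodicIRBound` from the two OPEN registered stubs S1₁, S6** (the landed S4₁ p162986 and S5₁ p162927 are used by name
inside; glue `periodicIRBound_of_floatingPair` of the v11 Defs module). [folklore] -/
theorem PeriodicIRBound_of (h1 : Goal.stub_floatingPairTwoChannel) (h6 : Goal.stub_nonIntegrableHalf) : PeriodicIRBound :=
  periodicIRBound_of_floatingPair h1 stub_klsNearMinimiserPair stub_windowAssemblyPair h6

/-- **THE EQUIVALENCE, SORRY-FREE**: S1₁ ⟺ the integrable half of the crux (all nine v11 stubs landed). [folklore] -/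
theorem floatingPair_iff_integrableHalf_holds :
    FloatingPairTwoChannel ↔
      ∀ v : ℝ → ℝ≥0∞, IsRepulsiveFiniteRange v → (∫⁻ x : Space, v ‖x‖) ≠ ⊤ → IRBoundFor v :=
  floatingPairTwoChannel_iff_integrableHalf stub_klsNearMinimiserPair stub_windowAssemblyPair
    stub_exchangeCondensateBound stub_potCosLowerBound stub_fsumLowerBound stub_condensateFractionOfIR
    stub_pairSharesReal (softLocationOf_of_split stub_effectiveGapOf stub_softLocationOfGap)

/-- **The crux is EQUIVALENT to its two open stubs, SORRY-FREE**: `PeriodicIRBound ↔ S1₁ ∧ S6`. [folklore] -/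
theorem periodicIRBound_iff_pair : PeriodicIRBound ↔ Goal.stub_floatingPairTwoChannel ∧ Goal.stub_nonIntegrableHalf := by
  rw [periodicIRBound_iff_split]
  exact ⟨fun h => ⟨floatingPair_iff_integrableHalf_holds.2 h.1, h.2⟩,
    fun h => ⟨floatingPair_iff_integrableHalf_holds.1 h.1, h.2⟩⟩

/-- **Corollary — the v10 load still closes the crux** (S1₀ as a hypothesis; S4₀, S5₀ landed). [folklore] -/
theorem PeriodicIRBound_of_low (h1 : FloatingTwoChannelLow) (h6 : Goal.stub_nonIntegrableHalf) : PeriodicIRBound :=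
  periodicIRBound_of_floatingLow h1 stub_klsNearMinimiserTZero stub_windowAssemblyTLow h6

/-- **Corollary — the v8 input still closes the crux** (S1' as a hypothesis). [folklore] -/
theorem PeriodicIRBound_of_strict (h1' : FloatingTwoChannel) (h6 : Goal.stub_nonIntegrableHalf) : PeriodicIRBound :=
  PeriodicIRBound_of_low (floatingTwoChannelLow_of_floatingTwoChannel h1') h6

/-- **Corollary — the v6 inputs still close the crux**: stmt-12620, stmt-9094 (hypotheses), S6. [folklore] -/
theorem PeriodicIRBound_of_pooled (hGD : GaussianDomination) (hC : EnergyConvexityWindow)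
    (h6 : Goal.stub_nonIntegrableHalf) : PeriodicIRBound :=
  PeriodicIRBound_of_low (floatingTwoChannelLow_of_pooled hGD hC) h6

/-- **LANDED FUNNEL (sorry-free): line 1's residual `C⁺ = LinearParticleHoleFloor` implies the v10 load S1₀**, by the
landed S9c p160421, S9a p160384, S9b p160612, S9' p160400. [folklore] -/
theorem floatingTwoChannelLow_of_linearParticleHoleFloor (hC : LinearParticleHoleFloor) : FloatingTwoChannelLow :=
  floatingTwoChannelLow_of_linearFloor
    (linearFloorGivesFloatingLow_of stub_latticeSectorEnergyFinite stub_channelsOfSectorGaps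
      stub_linearFloorGivesFloatingLowOf) stub_aeZeroFloatingLow hC

/-- **Corollary — line 1's residual closes the crux modulo the scope half only** (sorry-free in `hC`, `h6`). [folklore] -/
theorem PeriodicIRBound_of_linearParticleHoleFloor (hC : LinearParticleHoleFloor) (h6 : Goal.stub_nonIntegrableHalf) :
    PeriodicIRBound :=
  PeriodicIRBound_of_low (floatingTwoChannelLow_of_linearParticleHoleFloor hC) h6

/-- The skeleton applied to the stubs: `PeriodicIRBound` modulo exactly S1₁ and S6 (and conversely, `periodicIRBound_iff_pair`). -/
theorem PeriodicIRBound_proof : PeriodicIRBound :=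
  PeriodicIRBound_of stub_floatingPairTwoChannel stub_nonIntegrableHalf

end Summit.AtomisticToContinuum.BoseEinsteinCondensation.Cruxes.PeriodicIRBound.TwoSectorGdTransfer

end
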